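import Summits.BirchSwinnertonDyer.BirchSwinnertonDyer.Theorems.UniversalToricDescentHeegnerLayerSignature
import Summits.BirchSwinnertonDyer.BirchSwinnertonDyer.Theorems.UniversalToricDescentResidualNormSpanQuotient
import Summits.BirchSwinnertonDyer.BirchSwinnertonDyer.Theorems.CumulativeHeegnerLeopoldtCumulativeHeegnerInclusionAtThreeLayerControl
import Literature.NumberTheory.EllipticCurves.LambdaAdicSelmerDataLevelProofs
import Literature.NumberTheory.EllipticCurves.FineSelmerCoefficientMapProofs
import Literature.NumberTheory.EllipticCurves.IwasawaSelmerProofs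
import HarnessLib

/-!
# Route UniversalToricDescent — K1 at a prime `𝔮 ∣ p` ⟹ the mod-`p` Selmer group of EVERY layer `K_n`, `n ≥ k`, has at least
# `pⁿ − p^k + 1` independent local directions at `𝔮` (brick 4 assembled: the RANK INPUT of the finite-level two-sided link,
# port stub `stub_residualLinkMult` of line `beta-road` v5 on crux `TwinAlgMuZeroAtThree`, stmt-BirchSwinnertonDyer-24737)

Lead prover bsd-wall-utd-p1 g23 (`--supports stmt-BirchSwinnertonDyer-24737`). Γ_K-world only. Objects at the layer `K_n = K̄^{κ.layerSubgroup n}`,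
`n = k + m`, coefficients `M = E[p]`:
* `S_n = Sel_p(E/K_n) = selmerTorsionOver (κ.layerSubgroup n) p ⊆ H¹(Γ_{K_n}, E[p])` (Kummer conditions everywhere, tree object);
* `Z_𝔮(n) = ⨅_σ conj_σ⁻¹ ker(res_{Γ_{K_n} ∩ D_𝔮}) ⊆ H¹(Γ_{K_n}, E[p])` — the classes whose localisations at ALL places of `K_n` above `𝔮`
  vanish; `S_n ⧸ (S_n ∩ Z_𝔮(n))` is the image of `S_n` in the local mod-`p` cohomology at `𝔮`.

**`pow_le_natCard_selmerTorsion_quotient_of_K1`**: for a norm-coherent Heegner family (`α² = 1`) with K1 at `𝔮` at layer `k`, under (H0) at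
`𝔮` for the layer `n = k + m` and `Sel_p(E/K_n)` finite: `p^{pⁿ − p^k + 1} ≤ #(S_n ⧸ (S_n ∩ Z_𝔮(n)))`. Assembly of
`…HeegnerLayerSignature.resOfLe_sum_conjH1_kummerClassOver_ne_zero` (p738502: the norm of `δ_{K_n}(Q_n)` is not in `Z_𝔮(n)`) and
`…ResidualNormSpanQuotient.pow_le_natCard_quotient_of_sum_pow_apply_not_mem` (p738711) with `φ = conj_γ|_{S_n}` (`γ^{pⁿ} ∈ Γ_{K_n}` acts
trivially: `conjH1_of_mem_holds`). THEOREMS ONLY (no definition, no named fact, no `sorry`). BSD is not advanced by this file.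
References: [Castella2017HeegnerBeilinsonFlach] App. A (A.4); [BertoliniDarmon1996] §2.5; [Washington1997] §13.2.
-/

set_option linter.dupNamespace false
set_option autoImplicit false

noncomputable section

open scoped Classical
open Finset

namespace Summit.BirchSwinnertonDyer.BirchSwinnertonDyer.Theorems.UniversalToricDescentResidualLinkLayerRank

open Field NumberField IsDedekindDomain Literature.NumberTheory.EllipticCurves WeierstrassCurve
  Literature.NumberTheory.EllipticCurves.GreenbergSelmer
open Summit.BirchSwinnertonDyer.BirchSwinnertonDyer.Theorems.UniversalToricDescentHeegnerLayerSignature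
  Summit.BirchSwinnertonDyer.BirchSwinnertonDyer.Theorems.UniversalToricDescentResidualNormSpanQuotient
  Summit.BirchSwinnertonDyer.BirchSwinnertonDyer.Theorems.CumulativeHeegnerInclusionAtThreeLayerControl

universe u

variable {K : Type} [Field K] [NumberField K] {N : ℕ} [NeZero N] {W : WeierstrassCurve ℚ}
  {p : ℕ} [hp : Fact p.Prime] {κ : ZpExtension K p} {jbar : AlgebraicClosure K →+* ℂ}

/-- **K1 at `𝔮` ⟹ `p^{pⁿ − p^k + 1} ≤ #(Sel_p(E/K_n) ⧸ (Sel_p(E/K_n) ∩ Z_𝔮(n)))` for `n = k + m`** (module docstring).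
Hypotheses: a coherent Heegner family (`α² = 1`, `IsNormCompatible`), K1 at `𝔮` at layer `k` (the registered stub's clause, at the subgroup
`Γ_{K_k} ∩ D_𝔮`), (H0) at `𝔮` for the layer `n` («no non-zero point of `E[p]` fixed by `Γ_{K_n} ∩ D_𝔮`»), and finiteness of `Sel_p(E/K_n)`.
[cite: Castella2017HeegnerBeilinsonFlach, App. A (A.4)] [cite: BertoliniDarmon1996, §2.5 eq. (7)] [cite: Washington1997, §13.2] -/
theorem pow_le_natCard_selmerTorsion_quotient_of_K1 (F : HeegnerFamily N W K κ jbar)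
    {γ : absoluteGaloisGroup K} {α : ℤ} (hα : α ^ 2 = 1) (hcoh : F.IsNormCompatible γ α)
    (𝔮 : HeightOneSpectrum (𝓞 K)) (k m : ℕ)
    (h0 : ∀ t : geomTorsion (W.baseChange K) (p : ℤ),
      (∀ σ ∈ κ.layerSubgroup (k + m) ⊓ decomp 𝔮, σ • t = t) → t = 0)
    (hK1 : ∀ (Q : geomPoints (W.baseChange K))
      (hQ : ∀ σ ∈ κ.layerSubgroup k ⊓ decomp 𝔮, σ • ((p : ℤ) • Q) = (p : ℤ) • Q),
      (p : ℤ) • Q = F.z k → (W.baseChange K).kummerClassOver (κ.layerSubgroup k ⊓ decomp 𝔮) p Q hQ ≠ 0)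
    (hfin : ((W.baseChange K).selmerTorsionOver (κ.layerSubgroup (k + m)) (p : ℤ) :
      Set ((W.baseChange K).torsionH1Over (p : ℤ) (κ.layerSubgroup (k + m)))).Finite) :
    p ^ (p ^ (k + m) - p ^ k + 1) ≤
      Nat.card (↥((W.baseChange K).selmerTorsionOver (κ.layerSubgroup (k + m)) (p : ℤ)) ⧸
        (⨅ σ : absoluteGaloisGroup K,
          (AddMonoidHom.ker (Literature.NumberTheory.EllipticCurves.resOfLe (↥(geomTorsion (W.baseChange K) (p : ℤ)))
            (inf_le_left : κ.layerSubgroup (k + m) ⊓ decomp 𝔮 ≤ κ.layerSubgroup (k + m)))).comap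
            (Literature.NumberTheory.EllipticCurves.conjH1 (κ.layerSubgroup (k + m))
              (↥(geomTorsion (W.baseChange K) (p : ℤ))) σ)).addSubgroupOf
          ((W.baseChange K).selmerTorsionOver (κ.layerSubgroup (k + m)) (p : ℤ))) := by
  -- notation
  set V := W.baseChange K with hV
  set n := k + m with hn
  set M : Type := ↥(geomTorsion V (p : ℤ)) with hM
  set H := κ.layerSubgroup n with hH
  set S : AddSubgroup (V.torsionH1Over (p : ℤ) H) := V.selmerTorsionOver H (p : ℤ) with hS
  set Z : AddSubgroup (V.torsionH1Over (p : ℤ) H) := ⨅ σ : absoluteGaloisGroup K,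
    (AddMonoidHom.ker (Literature.NumberTheory.EllipticCurves.resOfLe M (inf_le_left : H ⊓ decomp 𝔮 ≤ H))).comap
      (Literature.NumberTheory.EllipticCurves.conjH1 H M σ) with hZ
  have hp0 : (p : ℤ) ≠ 0 := by exact_mod_cast hp.out.ne_zero
  -- membership in `Z`
  have hmemZ : ∀ x : V.torsionH1Over (p : ℤ) H, x ∈ Z ↔
      ∀ σ : absoluteGaloisGroup K, Literature.NumberTheory.EllipticCurves.resOfLe M (inf_le_left : H ⊓ decomp 𝔮 ≤ H)
        (Literature.NumberTheory.EllipticCurves.conjH1 H M σ x) = 0 := by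
    intro x
    simp only [hZ, AddSubgroup.mem_iInf, AddSubgroup.mem_comap, AddMonoidHom.mem_ker]
  -- `S` is killed by `p`
  have hSp : ∀ s : S, p • s = 0 := fun s ↦
    Subtype.ext (by
      rw [AddSubgroupClass.coe_nsmul, ZeroMemClass.coe_zero]
      exact FineSelmerCoefficientMap.p_smul_subgroupH1_geomTorsion_eq_zero V H _)
  -- `conj_γ` restricted to `S`
  have hconjS : ∀ (τ : absoluteGaloisGroup K) (s : V.torsionH1Over (p : ℤ) H), s ∈ S →
      Literature.NumberTheory.EllipticCurves.conjH1 H M τ s ∈ S :=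
    fun τ s hs ↦ WeierstrassCurve.LambdaAdicSelmerDataExists.conjH1_mem_selmerTorsionOver V H (p : ℤ) τ hs
  let φ : AddMonoid.End S :=
    (Literature.NumberTheory.EllipticCurves.conjH1 H M γ).restrict S |>.codRestrict S
      (fun s ↦ hconjS γ s.1 s.2)
  have hφpow : ∀ (j : ℕ) (s : S),
      ((φ ^ j) s : V.torsionH1Over (p : ℤ) H) = Literature.NumberTheory.EllipticCurves.conjH1 H M (γ ^ j) s := by
    intro j
    induction j with
    | zero =>
      intro s
      rw [pow_zero, pow_zero, AddMonoid.End.coe_one, id_eq, conjH1_one_holds H M, AddMonoidHom.id_apply]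
    | succ j ih =>
      intro s
      rw [pow_succ, AddMonoid.End.coe_mul, Function.comp_apply, ih, pow_succ,
        conjH1_mul_holds H M, AddMonoidHom.comp_apply]
      rfl
  -- `Z ∩ S` is `φ`-stable
  have hφZ : ∀ s ∈ Z.addSubgroupOf S, φ s ∈ Z.addSubgroupOf S := by
    intro s hs
    rw [AddSubgroup.mem_addSubgroupOf] at hs ⊢
    rw [hmemZ] at hs ⊢
    intro σ
    have e : (φ s : V.torsionH1Over (p : ℤ) H) = Literature.NumberTheory.EllipticCurves.conjH1 H M γ s := rfl
    have e2 : Literature.NumberTheory.EllipticCurves.conjH1 H M σ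
        (Literature.NumberTheory.EllipticCurves.conjH1 H M γ s) =
        Literature.NumberTheory.EllipticCurves.conjH1 H M (σ * γ) s := by
      rw [conjH1_mul_holds H M σ γ, AddMonoidHom.comp_apply]
    rw [e, e2]
    exact hs (σ * γ)
  -- `φ^{pⁿ} = 1`: `γ^{pⁿ} ∈ Γ_{K_n}` acts trivially
  have hφN : φ ^ p ^ n = 1 := by
    refine DFunLike.ext _ _ fun s ↦ Subtype.ext ?_
    rw [hφpow, AddMonoid.End.coe_one, id_eq,
      conjH1_of_mem_holds H M (pow_prime_pow_mem_layerSubgroup κ γ n), AddMonoidHom.id_apply]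
  -- the Heegner class `u = δ_{K_n}(Q_n) ∈ S`
  obtain ⟨Qn, hQn⟩ := V.zsmul_geomPoints_surjective_of_charZero hp0 (F.z n)
  dsimp only at hQn
  have hQn' : ∀ σ ∈ H, σ • ((p : ℤ) • Qn) = (p : ℤ) • Qn := fun σ hσ ↦ by
    rw [hQn]; exact (F.isHeegnerNormPoint_z n).smul_eq_self hσ
  let u : S := ⟨V.kummerClassOver H p Qn hQn', V.kummerClassOver_mem_selmerTorsionOver H p Qn hQn'⟩
  -- its norm is not in `Z` (brick 4b)
  have hu : ∑ i ∈ range (p ^ m), (φ ^ (p ^ k * i)) u ∉ Z.addSubgroupOf S := by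
    intro hmem
    rw [AddSubgroup.mem_addSubgroupOf, hmemZ] at hmem
    have h1 := hmem 1
    rw [conjH1_one_holds H M, AddMonoidHom.id_apply, AddSubgroup.val_finsetSum] at h1
    simp_rw [hφpow] at h1
    exact resOfLe_sum_conjH1_kummerClassOver_ne_zero F hα hcoh (decomp 𝔮) k m h0 hK1 Qn hQn hQn' h1
  -- brick 4c
  haveI : Finite S := hfin.to_subtype
  haveI : Finite (S ⧸ Z.addSubgroupOf S) := inferInstance
  exact pow_le_natCard_quotient_of_sum_pow_apply_not_mem hSp (Z.addSubgroupOf S) φ hφZ hφN u k m hu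

end Summit.BirchSwinnertonDyer.BirchSwinnertonDyer.Theorems.UniversalToricDescentResidualLinkLayerRank

end
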